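import Mathlib.AlgebraicGeometry.Morphisms.Flat
import Literature.AlgebraicGeometry.HodgeTheory.HodgeConjectureQbarVoisinProofs
import Literature.AlgebraicGeometry.HodgeTheory.AlgebraicClassesPullback
import HarnessLib

/-!
# Pull-back along a Zariski-locally trivial `ℙʳ`-bundle preserves the support filtration

Route `BoundaryReadout` / `QbarEnvelope` of `HodgeConjecture`, crux `PullbackAlgebraic`
(stmt-HodgeConjecture-1071), line `normal_cone`, stub `stub_bundlePullback`. Let `q : E ⟶ X` be a
`ℂ`-morphism of smooth projective complex varieties which is, Zariski-locally over `X`, isomorphic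
over `X` to the projection `U × ℙʳ → U` (every point of `X` has an open neighbourhood `U` with an
isomorphism of `ℂ`-schemes `q⁻¹U ≅ U ⊗ ℙʳ_ℂ` commuting with the two maps to `U`). Then
`q^*(Nᶜ Hᵏ(X(ℂ); ℂ)) ⊆ Nᶜ Hᵏ(E(ℂ); ℂ)` on the tree's support carrier `supportedClasses`
(A. Grothendieck, Topology 8 (1969), §1: the filtration by codimension of support is functorial for
flat morphisms; R. Hartshorne, *Algebraic Geometry*, III Prop. 9.2 (b)–(c) and Prop. 9.5).

The proof: `q` is FLAT — flatness is Zariski-local on the target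
(`IsZariskiLocalAtTarget.of_forall_exists_morphismRestrict`), and over each trivialising `U` the
restriction `q ∣_ U` is the isomorphism `φ` followed by the first projection `U ⊗ ℙʳ → U`, a base
change of the structure morphism `ℙʳ_ℂ → Spec ℂ`, which is flat (everything is flat over a field);
then the tree's `map_mem_supportedClasses_of_flat` (flat pull-back respects the support filtration,
codimension not dropping along a flat morphism of locally Noetherian schemes) applies, smooth
projective varieties being locally Noetherian
(`Motives.IsSmoothProjective.isLocallyNoetherian_holds`).

## References

* [GrothendieckTopology1969] A. Grothendieck, Hodge's general conjecture is false for trivial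
  reasons, Topology 8 (1969), §1.
* [Hartshorne1977] R. Hartshorne, Algebraic Geometry, GTM 52 (1977), III Prop. 9.2 (b),(c) and
  Prop. 9.5.
-/

noncomputable section

-- `Summit.HodgeConjecture.HodgeConjecture.…` is the mandated namespace (single-conjunct summit).
set_option linter.dupNamespace false

namespace Summit.HodgeConjecture.HodgeConjecture.Theorems.PullbackAlgebraicNormalCone

open CategoryTheory AlgebraicGeometry MonoidalCategory CartesianMonoidalCategory
  Literature.AlgebraicGeometry Literature.AlgebraicGeometry.Motives
  Literature.AlgebraicGeometry.HodgeTheory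

namespace BundlePullback

/-- The first projection `pr_W : W ⊗ Y → W` of a product of `ℂ`-schemes is flat: it is the base
change of the structure morphism `Y → Spec ℂ`, and every morphism to the spectrum of a field is
flat. [cite: Hartshorne1977, III Prop. 9.2 (b)] -/
theorem flat_fst_left (W Y : SchemeOver ℂ) : Flat (fst W Y).left := by
  change Flat (Limits.pullback.fst W.hom Y.hom)
  haveI : Subsingleton ↥(Spec (CommRingCat.of ℂ)) :=
    inferInstanceAs (Subsingleton (PrimeSpectrum ℂ))
  exact MorphismProperty.pullback_fst _ _ inferInstance

/-- **A Zariski-locally trivial `ℙʳ`-bundle is flat.** If every point of `X` has an open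
neighbourhood `U` over which `q : E ⟶ X` is isomorphic, over `U`, to the projection
`U ⊗ ℙʳ_ℂ → U`, then `q` is flat: flatness is local on the target, and `q ∣_ U` is an isomorphism
followed by the flat projection `U ⊗ ℙʳ → U`. [cite: Hartshorne1977, III Prop. 9.2 (b),(c)] -/
theorem flat_left_of_locallyTrivial {r : ℕ} {X E : SchemeOver ℂ} (q : E ⟶ X)
    (htriv : ∀ x : X.left, ∃ U : X.left.Opens, x ∈ U ∧
      ∃ φ : (Over.mk ((q.left ⁻¹ᵁ U).ι ≫ E.hom) : SchemeOver ℂ) ≅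
          (Over.mk (U.ι ≫ X.hom) : SchemeOver ℂ) ⊗ Motives.projectiveSpace r ℂ,
        φ.hom.left ≫ (fst (Over.mk (U.ι ≫ X.hom) : SchemeOver ℂ)
          (Motives.projectiveSpace r ℂ)).left ≫ U.ι = (q.left ⁻¹ᵁ U).ι ≫ q.left) :
    Flat q.left := by
  refine IsZariskiLocalAtTarget.of_forall_exists_morphismRestrict (P := @Flat) fun x ↦ ?_
  obtain ⟨U, hxU, φ, hφ⟩ := htriv x
  refine ⟨U, hxU, ?_⟩
  -- the composite `φ ≫ pr_U` is flat: `φ` is an isomorphism and `pr_U` is flat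
  have hflat : Flat (φ.hom.left ≫ (fst (Over.mk (U.ι ≫ X.hom) : SchemeOver ℂ)
      (Motives.projectiveSpace r ℂ)).left) := by
    haveI := flat_fst_left (Over.mk (U.ι ≫ X.hom) : SchemeOver ℂ) (Motives.projectiveSpace r ℂ)
    infer_instance
  -- and it is `q ∣_ U`, both having the same composite with the monomorphism `U.ι`
  have hφ' : q.left ∣_ U ≫ U.ι =
      (φ.hom.left ≫
          (fst (Over.mk (U.ι ≫ X.hom) : SchemeOver ℂ) (Motives.projectiveSpace r ℂ)).left :
        (q.left ⁻¹ᵁ U : Scheme) ⟶ (U : Scheme)) ≫ U.ι := by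
    simp only [Category.assoc, morphismRestrict_ι]
    exact hφ.symm
  rw [(cancel_mono U.ι).mp hφ']
  exact hflat

end BundlePullback

/-- **Pull-back along a Zariski-locally trivial `ℙʳ`-bundle preserves the support filtration:
`q^*(Nᶜ Hᵏ(X(ℂ); ℂ)) ⊆ Nᶜ Hᵏ(E(ℂ); ℂ)`** for a `ℂ`-morphism `q : E ⟶ X` of smooth projective complex
varieties which is Zariski-locally over `X` isomorphic to `U ⊗ ℙʳ → U` (Grothendieck 1969, §1;
Hartshorne III Prop. 9.2 / 9.5). Such a `q` is flat (`BundlePullback.flat_left_of_locallyTrivial`: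
locally on the target a base change of the flat `ℙʳ_ℂ → Spec ℂ`), both schemes are locally
Noetherian (`Motives.IsSmoothProjective.isLocallyNoetherian_holds`), and flat pull-back respects the
support filtration (`map_mem_supportedClasses_of_flat`: a class dying off a closed `Z` of
codimension `≥ c` pulls back to a class dying off `q⁻¹Z`, of codimension `≥ c` since codimension
does not drop along a flat morphism). [cite: GrothendieckTopology1969, §1]
[cite: Hartshorne1977, III Prop. 9.2 (b),(c) and Prop. 9.5] -/
theorem stub_bundlePullback :
    ∀ ⦃n r : ℕ⦄ ⦃X E : SchemeOver ℂ⦄ (q : E ⟶ X), IsSmoothProjective n X →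
      IsSmoothProjective (n + r) E →
      (∀ x : X.left, ∃ U : X.left.Opens, x ∈ U ∧
        ∃ φ : (Over.mk ((q.left ⁻¹ᵁ U).ι ≫ E.hom) : SchemeOver ℂ) ≅
            (Over.mk (U.ι ≫ X.hom) : SchemeOver ℂ) ⊗ Motives.projectiveSpace r ℂ,
          φ.hom.left ≫ (fst (Over.mk (U.ι ≫ X.hom) : SchemeOver ℂ)
            (Motives.projectiveSpace r ℂ)).left ≫ U.ι = (q.left ⁻¹ᵁ U).ι ≫ q.left) →
      ∀ (k c : ℕ), ∀ x ∈ supportedClasses X k c,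
        complexBetti.map q k x ∈ supportedClasses E k c := by
  intro n r X E q hX hE htriv k c x hx
  haveI : Flat q.left := BundlePullback.flat_left_of_locallyTrivial q htriv
  haveI : IsLocallyNoetherian X.left := Motives.IsSmoothProjective.isLocallyNoetherian_holds hX
  haveI : IsLocallyNoetherian E.left := Motives.IsSmoothProjective.isLocallyNoetherian_holds hE
  exact map_mem_supportedClasses_of_flat q hx

end Summit.HodgeConjecture.HodgeConjecture.Theorems.PullbackAlgebraicNormalCone

end
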